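import Summits.BirchSwinnertonDyer.BirchSwinnertonDyer.Theorems.SchneiderFreeAdditiveX3AnticycControlAdditiveStubBaseCountTorsOfPT
import Summits.BirchSwinnertonDyer.BirchSwinnertonDyer.Theorems.SchneiderFreeAdditiveX3PoitouTateSelmerDualityHolds
import Summits.BirchSwinnertonDyer.BirchSwinnertonDyer.Theorems.SchneiderFreeAdditiveX3AnticycControlAdditiveKStubPtSurj
import Summits.BirchSwinnertonDyer.BirchSwinnertonDyer.Theorems.SchneiderFreeAdditiveX3AnticycControlAdditiveCruxOfBaseCountTors
import HarnessLib

/-!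
# Crux `AnticycControlAdditiveK` (route `SchneiderFreeAdditiveX3`, item stmt-BirchSwinnertonDyer-19295) BY NAME
# modulo PT (ii) AT TOTALLY COMPLEX FIELDS ONLY — the socket for the Ш²-readout road (`poitouTate_sha_tateDual_of_shaTwoObstruction`)

Cell `bsd-schneider-ideate`, seat `bsd-schneider-door-c6` (prover, generation 18).  PARTITION: board row B6 ∩ X3 ∩ sst-twist,
`r = 1`, of `Rank1Residual.partition` — CONTROL corner (crux `AnticycControlAdditiveK`, skeleton v3-K c0242a50; facts binder
`ControlFacts` (i) = `poitouTate_selmerStructure_duality` — a TREE THEOREM since door-c4 g18's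
`PoitouTateReduction.poitouTate_selmerStructure_duality_holds` —, (ii) = `poitouTate_sha_tateDual`).  bears_on: K1-door (r1,
B6∩X3-sst) (route-BirchSwinnertonDyer-SchneiderFreeAdditiveX3 item 18969 → 19295).

THE POINT.  After door-c4 g18's `stub_baseCountTors` / `anticycControlAdditiveK_of_sha_tateDual` the crux takes exactly ONE
hypothesis, PT (ii) `poitouTate_sha_tateDual K` — but quantified over EVERY number field `K`, whereas the crux consumes it only at
the frame's imaginary quadratic (hence totally complex) `K` (through the coinvariant atom `stub_coinv`,
`coinvariantsTrivialAt_of_finite_anyTorsion … (hPT2 K)`), and the cell bsd-wall's Ш²-readout road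
(`poitouTate_sha_tateDual_of_shaTwoObstruction`, bsd-line-chl-p2 g6, p619253) produces PT (ii) at TOTALLY COMPLEX `K` only.
This file re-runs door-c6 gen 5's assembly with the hypothesis restricted accordingly:

* `stub_coinv_of_sha_totallyComplex` — the aside `stub_coinv` (L10) from `∀ K totally complex, poitouTate_sha_tateDual K` and the
  crux's Kolyvagin antecedent (PT (i) by the tree theorem);
* **`anticycControlAdditiveK_of_sha_totallyComplex`** — `AnticycControlAdditiveK` BY NAME from
  `∀ K totally complex, poitouTate_sha_tateDual K` ALONE (atoms: door-c5's `stub_kerRes` / `stub_kerLoc`, door-c4 g18's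
  `stub_baseCountTors`, door-c6's `stub_ptSurj_of_kolyvagin`, the coinvariant atom above, route R1's Brink atom
  `r1LocalKernelOrderAt_of_anticyclotomicDecomposition`, door-c4's glue `additiveControlOnTreeAt_of_torsAtoms`).

HONEST FRAMING: CONDITIONAL (one hypothesis BY NAME, the cite-only PT (ii) at totally complex fields); closes nothing by itself;
BSD is not proved by any of this («closes rung: none»).

References: [JetchevSkinnerWan2017] Thm. 3.3.1, Prop. 3.2.1, Prop. 3.3.2, Lemma 3.3.3 (arXiv:1512.06894 pp. 10–12);
[MilneADT2006] I Thm. 4.10 (a),(b); [Brink2007] Thm. 2, Cor. 1; [Gross1991] Thm. 1.3.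
-/

noncomputable section

open scoped Classical

open Field NumberField IsDedekindDomain WeierstrassCurve
open Literature.NumberTheory.EllipticCurves Literature.NumberTheory.EllipticCurves.GreenbergSelmer
open Literature.NumberTheory.GaloisRepresentations
open Literature.NumberTheory.GaloisCohomology
open Literature.NumberTheory.EllipticCurves.ModularForms
  Literature.NumberTheory.EllipticCurves.Rank1Residual
  Literature.NumberTheory.EllipticCurves.Rank1Residual.Typed
  Summit.BirchSwinnertonDyer.Rank1Residual
  Summit.BirchSwinnertonDyer.Rank1Residual.X11b
  Summit.BirchSwinnertonDyer.Rank1Residual.X11b.AcSelmer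
  Summit.BirchSwinnertonDyer.Rank1Residual.X11b.LocBridge

set_option linter.dupNamespace false

namespace Summit.BirchSwinnertonDyer.BirchSwinnertonDyer.Theorems.SchneiderFreeAdditiveX3

open Summit.BirchSwinnertonDyer.BirchSwinnertonDyer.Theses.SchneiderFreeAdditiveX3
  Summit.BirchSwinnertonDyer.BirchSwinnertonDyer.Theorems.SchneiderFree
  Summit.BirchSwinnertonDyer.BirchSwinnertonDyer.Theorems.SchneiderFreeControlAtoms

/-- **The aside `stub_coinv` (L10, coinvariants of `E(K_∞^{ac})[p^∞]`) from PT (ii) AT TOTALLY COMPLEX FIELDS and the crux's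
Kolyvagin antecedent only** (door-c6 gen 5's `stub_coinv_of_poitouTate`, with PT (i) the tree theorem and PT (ii) consumed at the
frame's imaginary quadratic `K`, `IsTotallyComplex K` from `IsImaginaryQuadratic K`).  CONDITIONAL; BSD is not proved by this.
[cite: JetchevSkinnerWan2017, Lemma 3.3.3 (arXiv:1512.06894 p. 12)] [cite: MilneADT2006, Ch. I, Thm. 4.10(a),(b)] -/
theorem stub_coinv_of_sha_totallyComplex
    (hPT2 : ∀ (K : Type) [Field K] [NumberField K], IsTotallyComplex K → poitouTate_sha_tateDual K)
    (hKo : ∀ (N : ℕ) [NeZero N] (W : WeierstrassCurve ℚ) (K : Type) [Field K] [NumberField K],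
      Literature.NumberTheory.EllipticCurves.kolyvagin N W K) :
    ∀ (W : WeierstrassCurve ℚ) [W.IsElliptic] [W.IsGloballyMinimal] (p : ℕ) [Fact p.Prime],
      W.analyticRank = 1 → p ≠ 2 → ClassX3 W p → Additive.SubSemistableTwist W p →
      ∀ (N : ℕ) [NeZero N] (K : Type) [Field K] [NumberField K]
        (Dt : ModularParametrizationData W N) (H : HeegnerDatum N (NumberField.discr K)) (ι : K →+* ℂ)
        (P : (W.baseChange K).toAffine.Point),
        W.analyticRank = 1 → Additive.N10.Locus W p → W.conductorNorm ℤ = N →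
        ∀ hK : IsImaginaryQuadratic K,
        Odd (NumberField.discr K) → ¬ p ∣ Units.torsionOrder K → SatisfiesHeegnerHypothesis N K →
        (W.quadraticTwist (NumberField.discr K : ℚ)).entireLFunction 1 ≠ 0 →
        WeierstrassCurve.Affine.Point.map ι.toRatAlgHom P = heegnerPointComplex Dt H →
        ¬ IsOfFinAddOrder P →
        ∀ (κ : ZpExtension K p), κ.IsAnticyclotomic →
          ∀ (γ : Field.absoluteGaloisGroup K) [Fact (κ.IsTopGenerator γ)]
            (𝔭 : HeightOneSpectrum (𝓞 K)) (h𝔭 : ((p : ℕ) : 𝓞 K) ∈ 𝔭.asIdeal)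
            (he : 𝔭.asIdeal.ramificationIdx (𝓞 ℚ) = 1) (hf : 𝔭.asIdeal.inertiaDeg (𝓞 ℚ) = 1),
            X11b.CoinvariantsTrivialAt (W.baseChange K) p κ 𝔭 γ
 := by
  intro W _ _ p _ _ _ _ _ N _ K _ _ Dt H ι P _ hloc hN hK _ _ hHe _ hP hnt κ _ γ hγ 𝔭 h𝔭 _ _
  have hPT : poitouTate_selmerStructure_duality K :=
    PoitouTateReduction.poitouTate_selmerStructure_duality_holds (K := K)
  have hpN : p ∣ W.conductorNorm ℤ := dvd_conductorNorm_of_n10Locus hloc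
  have hsplit : SplitsIn K p := splitsIn_of_satisfiesHeegnerHypothesis hN hHe hpN
  obtain ⟨hrank, hSha⟩ := hKo N W K hK hHe ⟨Dt, H, ι, hP⟩ hnt
  have hfin : ∀ v : HeightOneSpectrum (𝓞 K), ((p : ℕ) : 𝓞 K) ∈ v.asIdeal →
      Finite (selmerAcBase (W.baseChange K) p v ∅) := fun v hv ↦ by
    obtain ⟨hev, hfv⟩ := degreeOne_of_splitsIn hK.1 hsplit hv
    exact finite_selmerAcBase_of_rankOne_anyTorsion W p K
      (poitouTate_sum_localTatePairing_eq_zero_of_selmerStructure_duality hPT) hK hsplit hrank hSha v hv hev hfv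
  exact coinvariantsTrivialAt_of_finite_anyTorsion W p hK hsplit hPT (hPT2 K hK.2) κ hγ.out h𝔭 hfin

/-- **The crux `AnticycControlAdditiveK` (item stmt-BirchSwinnertonDyer-19295) BY NAME from PT (ii) at TOTALLY COMPLEX fields
ALONE** — door-c6 gen 5's assembly re-run with every other input a tree theorem: (KER-res)/(KER-𝔭) `stub_kerRes` /
`stub_kerLoc` (door-c5), (P6-add-tors) `stub_baseCountTors_of_poitouTate` on `poitouTate_selmerStructure_duality_holds` (= door-c4 g18's `stub_baseCountTors`), (P9-𝓒)
`stub_ptSurj_of_kolyvagin` (door-c6 g18), (L10) `stub_coinv_of_sha_totallyComplex`, (P11) route R1's Brink atom, and door-c4's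
glue `additiveControlOnTreeAt_of_torsAtoms`.  The one hypothesis is exactly the output shape of bsd-wall's Ш²-readout road
(`poitouTate_sha_tateDual_of_shaTwoObstruction`, totally complex `K`).  CONDITIONAL (one cite-only hypothesis BY NAME); closes
nothing by itself; BSD is not proved by this.
[cite: JetchevSkinnerWan2017, Thm. 3.3.1 (arXiv:1512.06894 p. 11)] [cite: MilneADT2006, Ch. I, Thm. 4.10(a),(b)]
[cite: Brink2007, Thm. 2 and Cor. 1] -/
theorem anticycControlAdditiveK_of_sha_totallyComplex
    (hPT2 : ∀ (K : Type) [Field K] [NumberField K], IsTotallyComplex K → poitouTate_sha_tateDual K) :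
    AnticycControlAdditiveK := by
  intro hKo W _ _ p _ hr hp2 hX hS N _ K _ _ Dt H ι P hr' hloc hN hK hodd hunit hHe hL1 hP hnt κ hκ γ _
    𝔭 h𝔭 he hf
  have hpN : p ∣ W.conductorNorm ℤ := dvd_conductorNorm_of_n10Locus hloc
  have hsplit : SplitsIn K p := splitsIn_of_satisfiesHeegnerHypothesis hN hHe hpN
  obtain ⟨g, hg⟩ :=
    stub_kerRes W p hr hp2 hX hS N K Dt H ι P hr' hloc hN hK hodd hunit hHe hL1 hP hnt κ hκ γ 𝔭 h𝔭 he hf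
  obtain ⟨t, ht⟩ :=
    stub_kerLoc W p hr hp2 hX hS N K Dt H ι P hr' hloc hN hK hodd hunit hHe hL1 hP hnt κ hκ γ 𝔭 h𝔭 he hf
  obtain ⟨a, ha⟩ :=
    stub_baseCountTors_of_poitouTate (fun K _ _ => PoitouTateReduction.poitouTate_selmerStructure_duality_holds (K := K))
      hKo W p hr hp2 hX hS N K Dt H ι P hr' hloc hN hK hodd hunit hHe hL1 hP hnt κ hκ γ 𝔭 h𝔭 he hf g t hg ht
  exact additiveControlOnTreeAt_of_torsAtoms (W := W) hK hsplit hpN hκ γ 𝔭 h𝔭 (embAt K p 𝔭 h𝔭 he hf)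
    P g t a hg ht ha
    (stub_ptSurj_of_kolyvagin hKo W p hr hp2 hX hS N K Dt H ι P hr' hloc hN hK hodd hunit hHe hL1
      hP hnt κ hκ γ 𝔭 h𝔭 he hf)
    (stub_coinv_of_sha_totallyComplex hPT2 hKo W p hr hp2 hX hS N K Dt H ι P hr' hloc hN hK hodd hunit hHe
      hL1 hP hnt κ hκ γ 𝔭 h𝔭 he hf)
    (r1LocalKernelOrderAt_of_anticyclotomicDecomposition (W := W) (p := p)
      decomp_not_le_kerSubgroup_of_isAnticyclotomic_forall hp2 K hK κ hκ)

end Summit.BirchSwinnertonDyer.BirchSwinnertonDyer.Theorems.SchneiderFreeAdditiveX3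

end
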